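import Summits.AtomisticToContinuum.FouriersLaw.Theorems.EmbeddedDrudeMourreAbelThermodynamicLimitAnchoredCorrelationTails
import Summits.AtomisticToContinuum.FouriersLaw.Theorems.EmbeddedDrudeMourreAbelThermodynamicLimitFixedTimeOffsetMatchingProductForm
import Literature.MathematicalPhysics.KineticTheory.InfiniteChainSuperstableEstimates

/-!
# Leaf (B₀) `stub_fixedTimeOffsetMatching` of S4, dynamic half, part 3: the good event of the centred box and its
improbable complement
(crux `EmbeddedDrudeMourre.AbelThermodynamicLimit`, item stmt-AtomisticToContinuum-12596, line
`loomis-compact-horizon-witness`; `--supports` file proving the registered sub-goal `stub_centredBoxBadEvent`;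
closes nothing)

* §1 quartic pinning turns the conserved severed energy into box bounds: if `W_{0,R+1}(σ) ≤ lam ρ⁴/4` then along the
  severed flow of `Λ_R = {-R,…,R}` every box position is `≤ ρ` and every box momentum `≤ √(lam/2) ρ²`
  (`severedFlow_energy_bounds`), and the initial (= frozen outer) positions at `|j| ≤ R+1` are `≤ ρ`;
* §2 THE GOOD EVENT: local energy `≤ lam R²/4` and time-integrated squared momenta `∫₀ᵗ p_m(Φ_r)² dr ≤ R` on the window
  `|m - c_N| ≤ R + 1` force all positions of BOTH flows at `|j| ≤ R+1` into `[-ρ, ρ]` on `[0,t]`, `ρ = (2+2t)√R`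
  (kinematic bound `q(s)² ≤ 2q(0)² + 2t∫p²` of `JunctionLocality.NonBallistic`), and the severed box momenta `≤ √(lam/2) R`;
* §3 `stub_centredBoxBadEvent`: the complement has probability `≤ (2R+3)C/(lam R²/4) + (2R+3)·2027025 T⁸t⁸/R⁸` under
  `μ_{N,T} ⊗ W`, uniformly in `N` (Markov with the energy mean `(2R+3)C` of part 2; the one-site eighth-power tail of
  part (C), `pinnedChain_probSite_timeIntegral_momentum_sq_gt_eight`; union bound over the `2R+3` window sites).

All statements proved; `[folklore]`. No definitions.
-/

noncomputable section

namespace Summit.AtomisticToContinuum.FouriersLaw.Theorems.AbelThermodynamicLimit.LoomisCompactHorizonWitness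

open MeasureTheory ProbabilityTheory Set Filter Topology Function
open scoped NNReal ENNReal
open Literature.MathematicalPhysics.KineticTheory Literature.MathematicalPhysics.KineticTheory.HeatConduction
open Literature.Probability.Process OscillatorChain
open Summit.AtomisticToContinuum.FouriersLaw.Theorems.NonBallistic
variable {N : ℕ} {ω₂ lam β γ : ℝ}

/-! ### §1 Deterministic consequences of the severed energy bound (quartic pinning) -/

section Severed

/-- `q⁴ ≤ ρ⁴` with `ρ ≥ 0` gives `|q| ≤ ρ`. [folklore] -/
theorem abs_le_of_pow_four_le {q ρ : ℝ} (hρ : 0 ≤ ρ) (h : q ^ 4 ≤ ρ ^ 4) : |q| ≤ ρ := by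
  have h' : |q| ^ 4 ≤ ρ ^ 4 := by rwa [show |q| ^ 4 = q ^ 4 by rw [show (4:ℕ) = 2 * 2 by rfl, pow_mul, sq_abs, ← pow_mul]]
  exact (pow_le_pow_iff_left₀ (abs_nonneg q) hρ (by norm_num)).1 h'

/-- **Positions and momenta along the severed flow of the centred box from the local energy bound.** For the
pinned chain (`ω₂ ≥ 0`, `lam > 0`, `β ≥ 0`), if `W_{0,R+1}(σ) ≤ lam ρ⁴/4` (Buttà–Marchioro's local energy of the box
`{-(R+1),…,R+1}`), then along `T^{Λ_R}_s σ`, `Λ_R = {-R,…,R}`, every box position satisfies `|q_i(s)| ≤ ρ` and every box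
momentum `|p_i(s)| ≤ √(lam/2) ρ²` (conservation of the severed energy, `lam q⁴/4 ≤ U(q)`, `p²/2 ≤ H`); the outer
neighbours are frozen. [folklore] -/
theorem severed_box_bounds (hω : 0 ≤ ω₂) (hl : 0 < lam) (hβ : 0 ≤ β) (γ : ℝ)
    (hB1 : (pinnedChain ω₂ lam β γ).CondB1) (R : ℕ) (σ : ChainConfig) {ρ : ℝ} (hρ : 0 ≤ ρ)
    (hW : (pinnedChain ω₂ lam β γ).bmLocalEnergy 0 (R + 1) σ ≤ lam * ρ ^ 4 / 4) (s : ℝ) (i : ℤ)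
    (hi : i ∈ Finset.Icc (-(R : ℤ)) R) :
    |(severedFlow hB1 (Finset.Icc (-(R : ℤ)) R) s σ i).1| ≤ ρ ∧
      |(severedFlow hB1 (Finset.Icc (-(R : ℤ)) R) s σ i).2| ≤ Real.sqrt (lam / 2) * ρ ^ 2 := by
  have hU : ContDiff ℝ 2 (pinnedChain ω₂ lam β γ).U := (pinnedChain_isEvenPolyOfDegree_U β γ hω hl).contDiff_two
  have hV : ContDiff ℝ 2 (pinnedChain ω₂ lam β γ).V := by
    show ContDiff ℝ 2 fun r : ℝ => r ^ 2 / 2 + β * r ^ 4 / 4; fun_prop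
  have hU0 : ∀ r, 0 ≤ (pinnedChain ω₂ lam β γ).U r := fun r => pinnedChain_U_nonneg β γ hω hl.le r
  have hV0 : ∀ r, 0 ≤ (pinnedChain ω₂ lam β γ).V r := fun r => by
    show 0 ≤ r ^ 2 / 2 + β * r ^ 4 / 4; positivity
  have hVe : ∀ r, (pinnedChain ω₂ lam β γ).V (-r) = (pinnedChain ω₂ lam β γ).V r := fun r => by
    show (-r) ^ 2 / 2 + β * (-r) ^ 4 / 4 = r ^ 2 / 2 + β * r ^ 4 / 4; ring
  have hbox : Finset.Icc (-(R : ℤ)) R = Finset.Icc ((0 : ℤ) - R) ((0 : ℤ) + R) := by simp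
  obtain ⟨hsite, -, -⟩ := severedFlow_energy_bounds hU hV hU0 hV0 hB1 hVe 0 R σ s
  have hi' : i ∈ Finset.Icc ((0 : ℤ) - R) ((0 : ℤ) + R) := by rwa [← hbox]
  obtain ⟨hp, hq⟩ := hsite i hi'
  rw [← hbox] at hp hq
  set q := (severedFlow hB1 (Finset.Icc (-(R : ℤ)) R) s σ i).1 with hqdef
  set p := (severedFlow hB1 (Finset.Icc (-(R : ℤ)) R) s σ i).2 with hpdef
  have hUq : lam * q ^ 4 / 4 ≤ (pinnedChain ω₂ lam β γ).U q := by
    show lam * q ^ 4 / 4 ≤ ω₂ * q ^ 2 / 2 + lam * q ^ 4 / 4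
    nlinarith [sq_nonneg q]
  constructor
  · refine abs_le_of_pow_four_le hρ ?_
    have : lam * q ^ 4 / 4 ≤ lam * ρ ^ 4 / 4 := hUq.trans (hq.trans hW)
    nlinarith
  · have h2 : p ^ 2 ≤ lam / 2 * ρ ^ 4 := by nlinarith [hp.trans hW]
    have h3 : |p| = Real.sqrt (p ^ 2) := (Real.sqrt_sq_eq_abs p).symm
    rw [h3]
    calc Real.sqrt (p ^ 2) ≤ Real.sqrt (lam / 2 * ρ ^ 4) := Real.sqrt_le_sqrt h2
      _ = Real.sqrt (lam / 2) * ρ ^ 2 := by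
          rw [Real.sqrt_mul (by positivity), show ρ ^ 4 = (ρ ^ 2) ^ 2 by ring, Real.sqrt_sq (by positivity)]

/-- The initial local energy also bounds the initial (= frozen) positions of the outer neighbours `±(R+1)` and all
initial box positions: `|q_j(0)| ≤ ρ` for `|j| ≤ R+1`. [folklore] -/
theorem initial_box_position_le (hω : 0 ≤ ω₂) (hl : 0 < lam) (β γ : ℝ) (hβ : 0 ≤ β) (R : ℕ) (σ : ChainConfig)
    {ρ : ℝ} (hρ : 0 ≤ ρ) (hW : (pinnedChain ω₂ lam β γ).bmLocalEnergy 0 (R + 1) σ ≤ lam * ρ ^ 4 / 4) (j : ℤ)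
    (hj : j ∈ Finset.Icc (-((R : ℤ) + 1)) ((R : ℤ) + 1)) : |(σ j).1| ≤ ρ := by
  have hU0 : ∀ r, 0 ≤ (pinnedChain ω₂ lam β γ).U r := fun r => pinnedChain_U_nonneg β γ hω hl.le r
  have hV0 : ∀ r, 0 ≤ (pinnedChain ω₂ lam β γ).V r := fun r => by
    show 0 ≤ r ^ 2 / 2 + β * r ^ 4 / 4; positivity
  have hj' : j ∈ Finset.Icc ((0 : ℤ) - ↑(R + 1)) ((0 : ℤ) + ↑(R + 1)) := by
    simp only [Finset.mem_Icc] at hj ⊢; push_cast; omega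
  have hsite := site_le_bmLocalEnergy hU0 hV0 (P := pinnedChain ω₂ lam β γ) (μ := 0) (k := R + 1) σ hj'
  have hUq : lam * (σ j).1 ^ 4 / 4 ≤ (pinnedChain ω₂ lam β γ).U (σ j).1 := by
    show lam * (σ j).1 ^ 4 / 4 ≤ ω₂ * (σ j).1 ^ 2 / 2 + lam * (σ j).1 ^ 4 / 4
    nlinarith [sq_nonneg (σ j).1]
  refine abs_le_of_pow_four_le hρ ?_
  have hp0 : 0 ≤ (σ j).2 ^ 2 / 2 := by positivity
  have : lam * (σ j).1 ^ 4 / 4 ≤ lam * ρ ^ 4 / 4 := by linarith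
  nlinarith

end Severed


/-! ### §2 On the good event both flows keep the box positions in `[-ρ, ρ]`, `ρ = (2 + 2t)√R` -/

section GoodEvent

/-- `√(a R) ≤ a √R` for `a ≥ 1`, `R ≥ 0`. [folklore] -/
theorem sqrt_mul_le_mul_sqrt {a : ℝ} (ha : 1 ≤ a) (R : ℝ) : Real.sqrt (a * R) ≤ a * Real.sqrt R := by
  rw [Real.sqrt_mul (zero_le_one.trans ha)]
  refine mul_le_mul_of_nonneg_right ?_ (Real.sqrt_nonneg _)
  rw [Real.sqrt_le_left (zero_le_one.trans ha)]
  nlinarith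

/-- **The good event of the centred box.** For the pinned chain (all parameters admissible, `lam > 0`), `2R + 4 ≤ N`,
`R ≥ 1`, `t ≥ 0` and a sample `(z, ω)` with (i) local energy `W_{0,R+1}(ι_N z) ≤ lam R²/4` and (ii) time-integrated
squared momenta `∫₀ᵗ p_m(Φ_r)² dr ≤ R` at every chain site `m` of the window `|m - c_N| ≤ R + 1`: along BOTH the open
chain `Φ_s(z, Bω)` (read through `ι_N`) and the severed flow `T^{Λ_R}_s(ι_N z)` every position at the sites
`|j| ≤ R + 1` stays in `[-ρ, ρ]` on `[0, t]`, `ρ = (2 + 2t)√R` (kinematic bound `q(s)² ≤ 2q(0)² + 2t∫p²`; conservation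
of the severed energy with quartic pinning; frozen outer neighbours), and the severed box momenta at time `t` are
`≤ √(lam/2) R`. [folklore] -/
theorem good_event_bounds (hω : 0 < ω₂) (hl : 0 < lam) (hβ : 0 ≤ β) (hγ : 0 ≤ γ)
    (hB1 : (pinnedChain ω₂ lam β γ).CondB1) (ι : (N : ℕ) → PhaseSpace N → ChainConfig)
    (hι : ∀ (N : ℕ) (z : PhaseSpace N) (i : ℤ), ι N z i =
      if h : 0 ≤ i + ((N - 1) / 2 : ℕ) ∧ i + ((N - 1) / 2 : ℕ) < N then
        (z.1 ⟨(i + ((N - 1) / 2 : ℕ)).toNat, by omega⟩, z.2 ⟨(i + ((N - 1) / 2 : ℕ)).toNat, by omega⟩)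
      else (0, 0))
    {R : ℕ} (hRN : 2 * R + 4 ≤ N) (hR1 : 1 ≤ R) (T : ℝ) {t : ℝ} (ht : 0 ≤ t) (q : PhaseSpace N × WienerPair)
    (hW : (pinnedChain ω₂ lam β γ).bmLocalEnergy 0 (R + 1) (ι N q.1) ≤ lam * (R : ℝ) ^ 2 / 4)
    (hX : ∀ m : Fin N, -((R : ℤ) + 1) ≤ (m : ℤ) - ((N - 1) / 2 : ℕ) → (m : ℤ) - ((N - 1) / 2 : ℕ) ≤ (R : ℤ) + 1 →
      ∫ r in (0:ℝ)..t, ((pinnedChain ω₂ lam β γ).solMap N T T r q.1 (pairPath q.2)).2 m ^ 2 ≤ R) :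
    (∀ s ∈ Icc (0:ℝ) t, ∀ j : ℤ, -((R : ℤ) + 1) ≤ j → j ≤ (R : ℤ) + 1 →
      |(ι N ((pinnedChain ω₂ lam β γ).chainFlow N q.1 (chainNoise N (Real.sqrt (2 * (pinnedChain ω₂ lam β γ).γ * T))
        (Real.sqrt (2 * (pinnedChain ω₂ lam β γ).γ * T)) (pairPath q.2)) s) j).1| ≤ (2 + 2 * t) * Real.sqrt R ∧
      |(severedFlow hB1 (Finset.Icc (-(R : ℤ)) R) s (ι N q.1) j).1| ≤ (2 + 2 * t) * Real.sqrt R) ∧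
    ∀ i ∈ Finset.Icc (-(R : ℤ)) R, |(severedFlow hB1 (Finset.Icc (-(R : ℤ)) R) t (ι N q.1) i).2| ≤
      Real.sqrt (lam / 2) * R := by
  set P := pinnedChain ω₂ lam β γ with hP
  have hR0 : (0 : ℝ) ≤ R := by positivity
  have hsq : Real.sqrt (R : ℝ) ^ 2 = R := Real.sq_sqrt hR0
  have hsq4 : Real.sqrt (R : ℝ) ^ 4 = (R : ℝ) ^ 2 := by rw [show (4:ℕ) = 2 * 2 by rfl, pow_mul, hsq]
  have hW' : P.bmLocalEnergy 0 (R + 1) (ι N q.1) ≤ lam * Real.sqrt (R : ℝ) ^ 4 / 4 := by rw [hsq4]; exact hW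
  have hρ1 : Real.sqrt (R : ℝ) ≤ (2 + 2 * t) * Real.sqrt R := le_mul_of_one_le_left (Real.sqrt_nonneg _) (by linarith)
  -- initial positions of the window from the local energy
  have hinit : ∀ j : ℤ, -((R : ℤ) + 1) ≤ j → j ≤ (R : ℤ) + 1 → |(ι N q.1 j).1| ≤ Real.sqrt R := fun j hj1 hj2 =>
    initial_box_position_le hω.le hl β γ hβ R (ι N q.1) (Real.sqrt_nonneg _) hW' j (by simp only [Finset.mem_Icc]; omega)
  refine ⟨fun s hs j hj1 hj2 => ⟨?_, ?_⟩, fun i hi => ?_⟩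
  · -- open chain: kinematic bound at the chain site `m = j + c_N`
    have hj0 : 0 ≤ j + ((N - 1) / 2 : ℕ) := by omega
    set m : Fin N := ⟨(j + ((N - 1) / 2 : ℕ)).toNat, by omega⟩ with hmdef
    have hmj : (m : ℤ) = j + ((N - 1) / 2 : ℕ) := by
      show (((j + ((N - 1) / 2 : ℕ)).toNat : ℕ) : ℤ) = j + ((N - 1) / 2 : ℕ); exact Int.toNat_of_nonneg hj0
    have happ : ∀ y : PhaseSpace N, ι N y j = (y.1 m, y.2 m) := fun y => centredEmbedding_apply_of_eq ι hι y j m hmj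
    have hkin := pinnedChain_solMap_position_sq_le ω₂ lam β γ hω hl.le hβ hγ N T T q.1 (pairPath q.2) t s hs m
    have hq0 : q.1.1 m ^ 2 ≤ R := by
      have h := hinit j hj1 hj2
      rw [happ] at h
      have h2 : |q.1.1 m| ^ 2 ≤ Real.sqrt (R : ℝ) ^ 2 := pow_le_pow_left₀ (abs_nonneg _) h 2
      rwa [sq_abs, hsq] at h2
    have hXm := hX m (by rw [hmj]; omega) (by rw [hmj]; omega)
    have hpos : (P.solMap N T T s q.1 (pairPath q.2)).1 m ^ 2 ≤ (2 + 2 * t) * R := by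
      calc _ ≤ 2 * q.1.1 m ^ 2 + 2 * t * ∫ r in (0:ℝ)..t, (P.solMap N T T r q.1 (pairPath q.2)).2 m ^ 2 := hkin
        _ ≤ 2 * R + 2 * t * R := by nlinarith [hs.1.trans hs.2]
        _ = (2 + 2 * t) * R := by ring
    show |(ι N (P.solMap N T T s q.1 (pairPath q.2)) j).1| ≤ (2 + 2 * t) * Real.sqrt R
    rw [happ]
    calc |(P.solMap N T T s q.1 (pairPath q.2)).1 m| = Real.sqrt ((P.solMap N T T s q.1 (pairPath q.2)).1 m ^ 2) :=
          (Real.sqrt_sq_eq_abs _).symm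
      _ ≤ Real.sqrt ((2 + 2 * t) * R) := Real.sqrt_le_sqrt hpos
      _ ≤ (2 + 2 * t) * Real.sqrt R := sqrt_mul_le_mul_sqrt (by linarith) _
  · -- severed flow: box sites by energy conservation, outer neighbours frozen
    by_cases hjΛ : j ∈ Finset.Icc (-(R : ℤ)) R
    · exact ((severed_box_bounds hω.le hl hβ γ hB1 R (ι N q.1) (Real.sqrt_nonneg _) hW' s j hjΛ).1).trans hρ1
    · rw [severedFlow_apply_of_not_mem hB1 _ s _ hjΛ]
      exact (hinit j hj1 hj2).trans hρ1
  · have h := (severed_box_bounds hω.le hl hβ γ hB1 R (ι N q.1) (Real.sqrt_nonneg _) hW' t i hi).2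
    rwa [hsq] at h

end GoodEvent

/-! ### §3 The bad event is improbable, uniformly in `N` -/

section BadEvent

variable (hω : 0 < ω₂) (hl : 0 < lam) (hβ : 0 < β) (hγ : 0 < γ) {T : ℝ} (hT : 0 < T)
include hω hl hβ hγ hT

/-- **The bad event of the centred box is improbable, uniformly in `N`.** With the `N`-uniform mean `(2R+3)C` of the
local energy (`exists_lintegral_bmLocalEnergy_centred_le`): under `μ_{N,T} ⊗ W`, the probability that the local
energy `W_{0,R+1}(ι_N z)` exceeds `lam R²/4` OR some time-integrated squared momentum of the window `|m - c_N| ≤ R + 1`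
exceeds `R` is at most `(2R+3)C/(lam R²/4) + (2R+3) · 2027025 T⁸ t⁸/R⁸` (Markov; the one-site tail with the
eighth power of part (C), `pinnedChain_probSite_timeIntegral_momentum_sq_gt_eight`; union bound). [folklore] -/
theorem bad_event_le (ι : (N : ℕ) → PhaseSpace N → ChainConfig)
    (hι : ∀ (N : ℕ) (z : PhaseSpace N) (i : ℤ), ι N z i =
      if h : 0 ≤ i + ((N - 1) / 2 : ℕ) ∧ i + ((N - 1) / 2 : ℕ) < N then
        (z.1 ⟨(i + ((N - 1) / 2 : ℕ)).toNat, by omega⟩, z.2 ⟨(i + ((N - 1) / 2 : ℕ)).toNat, by omega⟩)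
      else (0, 0))
    {C : ℝ≥0∞} (hC : ∀ (N R : ℕ), 2 * R + 4 ≤ N →
      ∫⁻ z, ENNReal.ofReal ((pinnedChain ω₂ lam β γ).bmLocalEnergy 0 (R + 1) (ι N z))
          ∂((pinnedChain ω₂ lam β γ).gibbsMeasure N T) ≤ (2 * R + 3 : ℝ≥0∞) * C)
    {N R : ℕ} (hRN : 2 * R + 4 ≤ N) (hR1 : 1 ≤ R) {t : ℝ} (ht : 0 ≤ t) :
    (((pinnedChain ω₂ lam β γ).gibbsMeasure N T).prod wienerPair)
        ({q | lam * (R : ℝ) ^ 2 / 4 < (pinnedChain ω₂ lam β γ).bmLocalEnergy 0 (R + 1) (ι N q.1)} ∪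
          ⋃ m ∈ (Finset.univ.filter fun m : Fin N =>
              -((R : ℤ) + 1) ≤ (m : ℤ) - ((N - 1) / 2 : ℕ) ∧ (m : ℤ) - ((N - 1) / 2 : ℕ) ≤ (R : ℤ) + 1),
            {q | (R : ℝ) < ∫ r in (0:ℝ)..t, ((pinnedChain ω₂ lam β γ).solMap N T T r q.1 (pairPath q.2)).2 m ^ 2}) ≤
      (2 * R + 3 : ℝ≥0∞) * C / ENNReal.ofReal (lam * (R : ℝ) ^ 2 / 4) +
        (2 * R + 3 : ℝ≥0∞) * ENNReal.ofReal (2027025 * T ^ 8 * t ^ 8 / (R : ℝ) ^ 8) := by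
  set P := pinnedChain ω₂ lam β γ with hP
  set μ := P.gibbsMeasure N T with hμ
  haveI : IsProbabilityMeasure μ := pinnedChain_isProbabilityMeasure_gibbsMeasure hω hl.le hβ.le γ N hT
  have hN : 0 < N := by omega
  set S : Finset (Fin N) := Finset.univ.filter fun m : Fin N =>
    -((R : ℤ) + 1) ≤ (m : ℤ) - ((N - 1) / 2 : ℕ) ∧ (m : ℤ) - ((N - 1) / 2 : ℕ) ≤ (R : ℤ) + 1 with hS
  -- the energy part: Markov on the first factor
  have hιm : Measurable (ι N) := measurable_centredEmbedding ι hι N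
  have hWm : Measurable fun z : PhaseSpace N => ENNReal.ofReal (P.bmLocalEnergy 0 (R + 1) (ι N z)) :=
    ((P.measurable_bmLocalEnergy (measurable_pinnedChain_U ω₂ lam β γ) (show Continuous P.V from by
      show Continuous fun r : ℝ => r ^ 2 / 2 + β * r ^ 4 / 4; fun_prop).measurable 0 (R + 1)).comp hιm).ennreal_ofReal
  have hE0 : 0 < lam * (R : ℝ) ^ 2 / 4 := by positivity
  have hA : {q : PhaseSpace N × WienerPair | lam * (R : ℝ) ^ 2 / 4 < P.bmLocalEnergy 0 (R + 1) (ι N q.1)} ⊆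
      Prod.fst ⁻¹' {z | ENNReal.ofReal (lam * (R : ℝ) ^ 2 / 4) ≤ ENNReal.ofReal (P.bmLocalEnergy 0 (R + 1) (ι N z))} :=
    fun q hq => ENNReal.ofReal_le_ofReal (le_of_lt hq)
  have h1 : (μ.prod wienerPair) {q : PhaseSpace N × WienerPair | lam * (R : ℝ) ^ 2 / 4 <
      P.bmLocalEnergy 0 (R + 1) (ι N q.1)} ≤ (2 * R + 3 : ℝ≥0∞) * C / ENNReal.ofReal (lam * (R : ℝ) ^ 2 / 4) := by
    have hmeasA : MeasurableSet {z : PhaseSpace N | ENNReal.ofReal (lam * (R : ℝ) ^ 2 / 4) ≤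
        ENNReal.ofReal (P.bmLocalEnergy 0 (R + 1) (ι N z))} := measurableSet_le measurable_const hWm
    calc (μ.prod wienerPair) {q : PhaseSpace N × WienerPair | lam * (R : ℝ) ^ 2 / 4 < P.bmLocalEnergy 0 (R + 1) (ι N q.1)}
        ≤ (μ.prod wienerPair) (Prod.fst ⁻¹' {z | ENNReal.ofReal (lam * (R : ℝ) ^ 2 / 4) ≤
            ENNReal.ofReal (P.bmLocalEnergy 0 (R + 1) (ι N z))}) := measure_mono hA
      _ = μ {z | ENNReal.ofReal (lam * (R : ℝ) ^ 2 / 4) ≤ ENNReal.ofReal (P.bmLocalEnergy 0 (R + 1) (ι N z))} := by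
          rw [← Set.prod_univ, Measure.prod_prod, measure_univ, mul_one]
      _ ≤ (∫⁻ z, ENNReal.ofReal (P.bmLocalEnergy 0 (R + 1) (ι N z)) ∂μ) / ENNReal.ofReal (lam * (R : ℝ) ^ 2 / 4) :=
          meas_ge_le_lintegral_div hWm.aemeasurable (ENNReal.ofReal_pos.2 hE0).ne' ENNReal.ofReal_ne_top
      _ ≤ (2 * R + 3 : ℝ≥0∞) * C / ENNReal.ofReal (lam * (R : ℝ) ^ 2 / 4) := ENNReal.div_le_div_right (hC N R hRN) _
  -- the momentum part: union bound over the window sites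
  have hcard : S.card ≤ 2 * R + 3 := by
    -- `S` injects into `{-(R+1), …, R+1}` by `m ↦ m - c_N`
    have hinj : S.card ≤ (Finset.Icc (-((R : ℤ) + 1)) ((R : ℤ) + 1)).card := by
      refine Finset.card_le_card_of_injOn (fun m : Fin N => (m : ℤ) - ((N - 1) / 2 : ℕ)) (fun m hm => ?_) ?_
      · have hm' := (Finset.mem_filter.1 hm).2
        simp only [Finset.coe_Icc, Set.mem_Icc]; exact hm'
      · intro a _ b _ hab
        have : (a : ℤ) = (b : ℤ) := by simpa using hab
        exact Fin.ext (by exact_mod_cast this)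
    rw [Int.card_Icc] at hinj
    have e : ((R : ℤ) + 1 + 1 - -((R : ℤ) + 1)).toNat = 2 * R + 3 := by omega
    rwa [e] at hinj
  have h2 : (μ.prod wienerPair) (⋃ m ∈ S, {q : PhaseSpace N × WienerPair |
      (R : ℝ) < ∫ r in (0:ℝ)..t, (P.solMap N T T r q.1 (pairPath q.2)).2 m ^ 2}) ≤
      (2 * R + 3 : ℝ≥0∞) * ENNReal.ofReal (2027025 * T ^ 8 * t ^ 8 / (R : ℝ) ^ 8) := by
    have hR0 : (0 : ℝ) < R := by exact_mod_cast hR1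
    calc (μ.prod wienerPair) (⋃ m ∈ S, {q : PhaseSpace N × WienerPair |
          (R : ℝ) < ∫ r in (0:ℝ)..t, (P.solMap N T T r q.1 (pairPath q.2)).2 m ^ 2})
        ≤ ∑ m ∈ S, (μ.prod wienerPair) {q : PhaseSpace N × WienerPair |
            (R : ℝ) < ∫ r in (0:ℝ)..t, (P.solMap N T T r q.1 (pairPath q.2)).2 m ^ 2} := measure_biUnion_finset_le _ _
      _ ≤ ∑ m ∈ S, ENNReal.ofReal (2027025 * T ^ 8 * t ^ 8 / (R : ℝ) ^ 8) :=
          Finset.sum_le_sum fun m _ => pinnedChain_probSite_timeIntegral_momentum_sq_gt_eight hω hl.le hβ.le hγ.le N hN hT ht hR0 m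
      _ = (S.card : ℝ≥0∞) * ENNReal.ofReal (2027025 * T ^ 8 * t ^ 8 / (R : ℝ) ^ 8) := by
          rw [Finset.sum_const, nsmul_eq_mul]
      _ ≤ (2 * R + 3 : ℝ≥0∞) * ENNReal.ofReal (2027025 * T ^ 8 * t ^ 8 / (R : ℝ) ^ 8) := by
          gcongr; exact_mod_cast hcard
  exact (measure_union_le _ _).trans (add_le_add h1 h2)

end BadEvent




/-- **Registered sub-goal `stub_centredBoxBadEvent`** (dynamic half of leaf (B₀), line `loomis-compact-horizon-witness`):
the bad event of the centred box is improbable uniformly in `N` (`bad_event_le`, closed form). [folklore] -/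
theorem stub_centredBoxBadEvent :
    ∀ ω₂ lam β γ : ℝ, 0 < ω₂ → 0 < lam → 0 < β → 0 < γ → ∀ T : ℝ, 0 < T →
      ∀ (ι : (N : ℕ) → Literature.MathematicalPhysics.KineticTheory.HeatConduction.PhaseSpace N → Literature.MathematicalPhysics.KineticTheory.HeatConduction.ChainConfig),
        (∀ (N : ℕ) (z : Literature.MathematicalPhysics.KineticTheory.HeatConduction.PhaseSpace N) (i : ℤ),
          ι N z i = if h : 0 ≤ i + ((N - 1) / 2 : ℕ) ∧ i + ((N - 1) / 2 : ℕ) < N then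
            (z.1 ⟨(i + ((N - 1) / 2 : ℕ)).toNat, by omega⟩, z.2 ⟨(i + ((N - 1) / 2 : ℕ)).toNat, by omega⟩)
            else (0, 0)) →
      ∀ (C : ENNReal), (∀ (N R : ℕ), 2 * R + 4 ≤ N →
        ∫⁻ z, ENNReal.ofReal ((Literature.MathematicalPhysics.KineticTheory.HeatConduction.pinnedChain ω₂ lam β γ).bmLocalEnergy 0 (R + 1) (ι N z))
            ∂((Literature.MathematicalPhysics.KineticTheory.HeatConduction.pinnedChain ω₂ lam β γ).gibbsMeasure N T) ≤ (2 * R + 3 : ENNReal) * C) →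
      ∀ (N R : ℕ), 2 * R + 4 ≤ N → 1 ≤ R → ∀ (t : ℝ), 0 ≤ t →
        (((Literature.MathematicalPhysics.KineticTheory.HeatConduction.pinnedChain ω₂ lam β γ).gibbsMeasure N T).prod Literature.Probability.Process.wienerPair)
            ({q : Literature.MathematicalPhysics.KineticTheory.HeatConduction.PhaseSpace N × Literature.Probability.Process.WienerPair |
                lam * (R : ℝ) ^ 2 / 4 < (Literature.MathematicalPhysics.KineticTheory.HeatConduction.pinnedChain ω₂ lam β γ).bmLocalEnergy 0 (R + 1) (ι N q.1)} ∪
              ⋃ m ∈ (Finset.univ.filter fun m : Fin N =>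
                  -((R : ℤ) + 1) ≤ (m : ℤ) - ((N - 1) / 2 : ℕ) ∧ (m : ℤ) - ((N - 1) / 2 : ℕ) ≤ (R : ℤ) + 1),
                {q : Literature.MathematicalPhysics.KineticTheory.HeatConduction.PhaseSpace N × Literature.Probability.Process.WienerPair | (R : ℝ) < ∫ r in (0:ℝ)..t,
                  ((Literature.MathematicalPhysics.KineticTheory.HeatConduction.pinnedChain ω₂ lam β γ).solMap N T T r q.1 (Literature.Probability.Process.pairPath q.2)).2 m ^ 2}) ≤
          (2 * R + 3 : ENNReal) * C / ENNReal.ofReal (lam * (R : ℝ) ^ 2 / 4) +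
            (2 * R + 3 : ENNReal) * ENNReal.ofReal (2027025 * T ^ 8 * t ^ 8 / (R : ℝ) ^ 8) :=
  fun _ _ _ _ hω hl hβ hγ _ hT ι hι _ hC _ _ hRN hR1 _ ht => bad_event_le hω hl hβ hγ hT ι hι hC hRN hR1 ht

end Summit.AtomisticToContinuum.FouriersLaw.Theorems.AbelThermodynamicLimit.LoomisCompactHorizonWitness

end
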